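import Mathlib.Probability.Independence.Integration
import Mathlib.Logic.Function.DependsOn
import HarnessLib

/-!
# Dimock, *The renormalization group according to Balaban* I, Appendix B, proof of THEOREM `\label{cluster}`, STEP 2 —
# *"because the Y_j are disjoint and because fields at different sites are independent random variables"* the
# fluctuation integral of a product of activities of disjoint polymers is the product of the integrated activities
# `K^#(Y) = ∫ K(Y,Φ) dμ(Φ)`, which obey the same bound (owl) — PROVED for every ultralocal (product) probability measure

**Citation header (reproduction of PUBLISHED work; template of the Bałaban lattice Yang–Mills cell).**
J. Dimock, *The renormalization group according to Balaban I. Small fields*, Rev. Math. Phys. **25** (2013) 1330010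
(= arXiv:1108.1335v2) [Dimock2013], Appendix B "cluster expansion": the ultralocal measure L3170–3173, proof of
THEOREM `\label{cluster}` step 2 TeX L3285–3299 with eq. (owl).  TeX line numbers refer to the arXiv source held by
the cell (`inputs/files/dimock/src/1108.1335/1108.1335.tex`).  Dimock's papers are published and refereed and are
the cell's TEMPLATE, not manuscripts under audit; no quantity of the Bałaban series is touched.

**What the paper prints (verbatim).**  L3170–3173: *"integrals of the form Ξ = ∫ exp(Σ_X H(X, Φ)) dμ(Φ) where dμ(Φ)
= Π_x dμ(Φ(x)) is an ultralocal probability measure."*  Step 2, L3285–3299: *"Now because the Y_j are disjoint and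
because fields at different sites are independent random variables ∫(Σ_{{Y_j}} Π_j K(Y_j,Φ)) dμ(Φ) = Σ_{{Y_j}} Π_j
K^#(Y_j) where K^#(Y) = ∫ K(Y,Φ) dμ(Φ) satisfies the same bound |K^#(Y)| ≤ O(1)H₀e^{−(κ−κ₀−2)d_M(Y)}"* (the bound
on `K(Y, Φ)` being L3278–3280, *"on the support of μ"*).

**What is reproduced here (kernel-checked, zero `sorry`), abstractly.**  Sites `S` (finite), a single-site measurable
space `E` with probability measures `ν_s`, fields `Φ : S → E` under the product measure `Measure.pi ν` (Mathlib) —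
the ultralocal measure; activities are measurable functionals `K : (S → E) → ℝ` that DEPEND ONLY ON THE FIELD IN A
BLOCK `Y ⊆ S` (Mathlib's `DependsOn K Y`: *"H(X, Φ) depending on Φ only in X"*, L3168).
* **`indepFun_of_dependsOn_disjoint`** — *"fields at different sites are independent random variables"*: two measurable
  functionals depending on DISJOINT blocks are independent (`ProbabilityTheory.IndepFun`) under `Measure.pi ν` —
  Mathlib's `iIndepFun_pi` (independence of the coordinates) and `iIndepFun.indepFun_finset` (disjoint blocks of an
  independent family), transported along the block restrictions (a functional depending on `Y` factors through
  `Φ ↦ Φ|_Y`).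
* **`integral_prod_eq_prod_integral`** — for a finite family of blocks `Y_j`, pairwise disjoint, and measurable
  block-local activities `K_j`: `∫ Π_j K_j(Φ) dμ(Φ) = Π_j ∫ K_j(Φ) dμ(Φ)` (induction on the family: the new block is
  independent of the product over the others, `IndepFun.integral_fun_mul_eq_mul_integral`); **`integral_prod_polymers`**
  — the printed indexing by the polymers themselves: `∫ Π_{Y∈𝒴} K(Y,Φ) dμ = Π_{Y∈𝒴} K^#(Y)`.
* **`abs_integral_le_of_abs_le`** — (owl): a bound `|K(Y,Φ)| ≤ C` for all `Φ` gives `|K^#(Y)| ≤ C`.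

**Readings (declared).**  (i) The printed identity is for the SUM over collections `{Y_j}` of disjoint polymers; the
content is the termwise factorisation (the finite sum commutes with the integral by linearity — finite volume, L3166
*"unit toroidal lattice"*), which is what is proved.  (ii) "The same bound" (owl) is taken with a bound valid for
all `Φ` (Dimock: *"on the support of μ"*; a `μ`-a.e. bound would do as well — `norm_integral_le_of_norm_le_const` —
not spelled out).  (iii) No integrability hypothesis is needed for the factorisation as stated in Mathlib
(`IndepFun.integral_fun_mul_eq_mul_integral` holds with Mathlib's conventions for non-integrable functions); in
Dimock's setting the activities are bounded anyway.

**What is NOT claimed.**  The specific Gaussian∕spin single-site measures of the text; the identification of `K` with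
step 1's `K(Y, Φ) = Σ Π (e^{H(X_i,Φ)} − 1)` (`MayerExpansion`, not imported — its `DependsOn`-type locality is the
hypothesis `hKd` here); (owl)'s right side `O(1)H₀e^{−(κ−κ₀−2)d_M(Y)}` (step 1, v8.73 `ClusterActivityBound`); anything
of B1–B16 (TEMPLATE.md §4.1 row «D1 §4.6» — grade there).  NOT summit progress; NOT a statement about any Bałaban
paper; NOT continuum; NOT Clay.  Mathlib-only leaf (`Mathlib.Probability.Independence.Integration`,
`Mathlib.Logic.Function.DependsOn`, `HarnessLib`); sub-namespace `…Dimock2011to13.UltralocalFactorization`; modifies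
nothing.  Unit `b2b-balaban-template` gen 33 round 6 (journal CLAIM D1-STEP2-KERNEL); cell records TEMPLATE.md §4.1
row «D1 §4.6», §15.2; GAPS C-tmpl33-8.

**Version.**  v1 (unit `b2b-balaban-template` gen 33 round 6).
-/

noncomputable section

open MeasureTheory ProbabilityTheory Finset

namespace Literature.MathematicalPhysics.QuantumFieldTheory.Dimock2011to13.UltralocalFactorization

variable {S : Type*} [Fintype S] [DecidableEq S] {E : Type*} [MeasurableSpace E]
  (ν : S → Measure E) [∀ s, IsProbabilityMeasure (ν s)]

omit [Fintype S] [MeasurableSpace E] in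
/-- a functional depending only on the block `Y` is read off the extension of the restriction. [folklore] -/
private theorem apply_extendBy_restrict {β : Type*} {f : (S → E) → β} {Y : Finset S}
    (hf : DependsOn f (Y : Set S)) (Φ₀ Φ : S → E) :
    f (fun x => if hx : x ∈ Y then (fun i : Y => Φ i) ⟨x, hx⟩ else Φ₀ x) = f Φ :=
  hf fun x hx => by simp [Finset.mem_coe.1 hx]

omit [Fintype S] in
/-- the extension map (block configuration + background off the block) is measurable. [folklore] -/
private theorem measurable_extendBy (Y : Finset S) (Φ₀ : S → E) :
    Measurable fun (ψ : Y → E) (x : S) => if hx : x ∈ Y then ψ ⟨x, hx⟩ else Φ₀ x := by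
  refine measurable_pi_lambda _ fun x => ?_
  by_cases hx : x ∈ Y
  · simp only [hx, dif_pos]
    exact measurable_pi_apply _
  · simp only [hx, dif_neg, not_false_eq_true]
    exact measurable_const

omit [DecidableEq S] in
include ν in
/-- the field space is non-empty (a probability measure lives on it). [folklore] -/
private theorem nonempty_fields : Nonempty (S → E) := by
  by_contra h
  rw [not_nonempty_iff] at h
  have h1 := measure_univ (μ := Measure.pi ν)
  rw [Set.univ_eq_empty_iff.2 h, measure_empty] at h1
  exact zero_ne_one h1

/-- **"FIELDS AT DIFFERENT SITES ARE INDEPENDENT RANDOM VARIABLES"** (L3286–3287) for the ultralocal measure `dμ(Φ) =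
Π_x dμ(Φ(x))` (L3172): two measurable functionals of the field depending on DISJOINT blocks of sites are independent
under the product measure — Mathlib's `iIndepFun_pi` (the coordinates are independent) and `iIndepFun.indepFun_finset`
(disjoint blocks of an independent family are independent), transported along the block restrictions.
[cite: Dimock2013, App. B Theorem cluster, proof step 2 (arXiv:1108.1335v2 TeX L3285–3299)] -/
theorem indepFun_of_dependsOn_disjoint {f g : (S → E) → ℝ} (hfm : Measurable f) (hgm : Measurable g)
    {Y Y' : Finset S} (hf : DependsOn f (Y : Set S)) (hg : DependsOn g (Y' : Set S)) (hYY' : Disjoint Y Y') :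
    IndepFun f g (Measure.pi ν) := by
  obtain ⟨Φ₀⟩ := nonempty_fields ν
  have hind : IndepFun (fun (Φ : S → E) (i : Y) => Φ i) (fun (Φ : S → E) (i : Y') => Φ i) (Measure.pi ν) := by
    have h : iIndepFun (fun i (Φ : S → E) => Φ i) (Measure.pi ν) :=
      iIndepFun_pi (X := fun _ : S => @id E) fun _ => aemeasurable_id
    exact h.indepFun_finset Y Y' hYY' fun i => measurable_pi_apply i
  have h1 : f = (fun ψ : Y → E => f (fun x => if hx : x ∈ Y then ψ ⟨x, hx⟩ else Φ₀ x)) ∘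
      fun (Φ : S → E) (i : Y) => Φ i := by
    funext Φ
    exact (apply_extendBy_restrict hf Φ₀ Φ).symm
  have h2 : g = (fun ψ : Y' → E => g (fun x => if hx : x ∈ Y' then ψ ⟨x, hx⟩ else Φ₀ x)) ∘
      fun (Φ : S → E) (i : Y') => Φ i := by
    funext Φ
    exact (apply_extendBy_restrict hg Φ₀ Φ).symm
  rw [h1, h2]
  exact hind.comp (hfm.comp (measurable_extendBy Y Φ₀)) (hgm.comp (measurable_extendBy Y' Φ₀))

omit [Fintype S] [MeasurableSpace E] in
/-- a product of block functionals depends only on the union of the blocks. [folklore] -/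
private theorem dependsOn_prod {ι : Type*} (s : Finset ι) (Y : ι → Finset S) (K : ι → (S → E) → ℝ)
    (hKd : ∀ j ∈ s, DependsOn (K j) (Y j : Set S)) :
    DependsOn (fun Φ => ∏ j ∈ s, K j Φ) ((s.biUnion Y : Finset S) : Set S) := by
  intro Φ Ψ h
  refine Finset.prod_congr rfl fun j hj => hKd j hj fun x hx => h x ?_
  exact Finset.mem_coe.2 (Finset.mem_biUnion.2 ⟨j, hj, Finset.mem_coe.1 hx⟩)

/-- **STEP 2: THE FLUCTUATION INTEGRAL FACTORISES OVER DISJOINT POLYMERS** (L3285–3295: *"Now because the Y_j are disjoint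
and because fields at different sites are independent random variables ∫(Σ_{{Y_j}} Π_j K(Y_j,Φ)) dμ(Φ) = Σ_{{Y_j}} Π_j
K^#(Y_j) where K^#(Y) = ∫ K(Y,Φ) dμ(Φ)"*), termwise and abstractly: for the ultralocal (product) probability measure
on fields `Φ : S → E` and a finite family of measurable functionals `K_j`, each depending only on the field in a
block `Y_j`, the blocks pairwise disjoint, `∫ Π_j K_j(Φ) dμ(Φ) = Π_j ∫ K_j(Φ) dμ(Φ)` — induction on the family,
one block against the union of the others (`indepFun_of_dependsOn_disjoint`, `IndepFun.integral_fun_mul_eq_mul_integral`).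
(The sum over the collections `{Y_j}` then commutes with the integral by linearity — a finite sum in finite volume.)
[cite: Dimock2013, App. B Theorem cluster, proof step 2 (arXiv:1108.1335v2 TeX L3285–3299)] -/
theorem integral_prod_eq_prod_integral {ι : Type*} [DecidableEq ι] (J : Finset ι) (Y : ι → Finset S)
    (hdisj : ∀ i ∈ J, ∀ j ∈ J, i ≠ j → Disjoint (Y i) (Y j)) (K : ι → (S → E) → ℝ)
    (hKm : ∀ j ∈ J, Measurable (K j)) (hKd : ∀ j ∈ J, DependsOn (K j) (Y j : Set S)) :
    ∫ Φ, ∏ j ∈ J, K j Φ ∂(Measure.pi ν) = ∏ j ∈ J, ∫ Φ, K j Φ ∂(Measure.pi ν) := by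
  induction J using Finset.induction_on with
  | empty => simp
  | insert a s has ih =>
    have hKm' : ∀ j ∈ s, Measurable (K j) := fun j hj => hKm j (Finset.mem_insert_of_mem hj)
    have hKd' : ∀ j ∈ s, DependsOn (K j) (Y j : Set S) := fun j hj => hKd j (Finset.mem_insert_of_mem hj)
    have hdisj' : ∀ i ∈ s, ∀ j ∈ s, i ≠ j → Disjoint (Y i) (Y j) :=
      fun i hi j hj hij => hdisj i (Finset.mem_insert_of_mem hi) j (Finset.mem_insert_of_mem hj) hij
    -- the new block is disjoint from the union of the old ones
    have hdj : Disjoint (Y a) (s.biUnion Y) := by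
      rw [Finset.disjoint_biUnion_right]
      intro j hj
      exact hdisj a (Finset.mem_insert_self a s) j (Finset.mem_insert_of_mem hj)
        (fun h => has (h ▸ hj))
    have hind : IndepFun (K a) (fun Φ => ∏ j ∈ s, K j Φ) (Measure.pi ν) :=
      indepFun_of_dependsOn_disjoint ν (hKm a (Finset.mem_insert_self a s))
        (Finset.measurable_prod s fun j hj => hKm' j hj) (hKd a (Finset.mem_insert_self a s))
        (dependsOn_prod s Y K hKd') hdj
    simp only [Finset.prod_insert has]
    rw [hind.integral_fun_mul_eq_mul_integral (hKm a (Finset.mem_insert_self a s)).aestronglyMeasurable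
      (Finset.measurable_prod s fun j hj => hKm' j hj).aestronglyMeasurable, ih hdisj' hKm' hKd']

omit [DecidableEq S] in
/-- **(owl): `K^#` SATISFIES THE SAME BOUND** (L3296–3299: *"where K^#(Y) = ∫ K(Y,Φ)dμ(Φ) satisfies the same bound
|K^#(Y)| ≤ O(1)H₀e^{−(κ−κ₀−2)d_M(Y)}"*): a pointwise bound on `|K(Y, ·)|` on the whole field space passes to the
integral against the probability measure. [cite: Dimock2013, App. B Theorem cluster, proof step 2 eq. (owl) (arXiv:1108.1335v2 TeX L3293–3299)] -/
theorem abs_integral_le_of_abs_le {K : (S → E) → ℝ} {C : ℝ} (hK : ∀ Φ, |K Φ| ≤ C) :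
    |∫ Φ, K Φ ∂(Measure.pi ν)| ≤ C := by
  have h := norm_integral_le_of_norm_le_const (μ := Measure.pi ν) (f := K) (C := C)
    (Filter.Eventually.of_forall fun Φ => by simpa [Real.norm_eq_abs] using hK Φ)
  simpa [Real.norm_eq_abs, measure_univ] using h

/-- **STEP 2 FOR A COLLECTION OF DISJOINT POLYMERS** — the printed form with one activity `K(Y, Φ)` indexed by the
polymers themselves: for a finite collection `𝒴` of pairwise disjoint blocks and a measurable activity `K(Y, ·)`
depending only on the field in `Y`, `∫ Π_{Y∈𝒴} K(Y,Φ) dμ(Φ) = Π_{Y∈𝒴} K^#(Y)` with `K^#(Y) = ∫ K(Y,Φ) dμ(Φ)`.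
[cite: Dimock2013, App. B Theorem cluster, proof step 2 (arXiv:1108.1335v2 TeX L3285–3299)] -/
theorem integral_prod_polymers (𝒴 : Finset (Finset S))
    (hdisj : ∀ Y ∈ 𝒴, ∀ Y' ∈ 𝒴, Y ≠ Y' → Disjoint Y Y') (K : Finset S → (S → E) → ℝ)
    (hKm : ∀ Y ∈ 𝒴, Measurable (K Y)) (hKd : ∀ Y ∈ 𝒴, DependsOn (K Y) (Y : Set S)) :
    ∫ Φ, ∏ Y ∈ 𝒴, K Y Φ ∂(Measure.pi ν) = ∏ Y ∈ 𝒴, ∫ Φ, K Y Φ ∂(Measure.pi ν) :=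
  integral_prod_eq_prod_integral ν 𝒴 id hdisj K hKm hKd

end Literature.MathematicalPhysics.QuantumFieldTheory.Dimock2011to13.UltralocalFactorization
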